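import Summits.HodgeConjecture.HodgeConjecture.Theorems.F0P3cStCharTSArtinMonoid         -- ★ p848426 «ARTIN-B»
import Summits.HodgeConjecture.HodgeConjecture.Theorems.F0P3cStCharTSShellKit           -- ★ (this seat) the shell kit: «MULT-ARTIN», «TORUS-GEN» (CM), dominance, shell trace, eigen-functional ⇒ T-map
import Summits.HodgeConjecture.HodgeConjecture.Theorems.F0P3bQCMTSignedOfSteinberg       -- ★ the P3b line's cone (every notion of the organ's binders: `finExplicitCollection`, `quadraticHeckeCharCM`, …)
import Summits.HodgeConjecture.HodgeConjecture.Theorems.F0P3cStCharTSTorusMultiset       -- ★ p848271 «TMULT» `exists_multiset_of_finrank_le_two`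
import Summits.HodgeConjecture.HodgeConjecture.Theorems.F0P3cStCharTSJacquetLine         -- ★ p848367 «JDIM2» `finrank_coinvariants_le_two`
import Summits.HodgeConjecture.HodgeConjecture.Theorems.F0P3LocalIrrepAdmissibleOfCuspidal  -- ★ `isAdmissible_irrClass_quasiSplit_of_cuspidal`
import Summits.HodgeConjecture.HodgeConjecture.Theorems.F0P3LocalIrrepAdmissibleThree     -- ★ `isSupercuspidal_of_subsingleton_coinvariants`
import Literature.NumberTheory.Automorphic.DoubleCosetHaarVolume                         -- ★ `DoubleCosetIndex.isCompact_doubleCoset`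
import Literature.NumberTheory.Rogawski1990.LocalTransferExistence                       -- ★ `IsLocalDeltaTransferExists` ((T_v))
import Literature.NumberTheory.Rogawski1990.LocalTransferFundamentalLemma                -- ★ `IsLocSmooth`, `isLocSmooth_indicator`
import HarnessLib

/-!
# F0 · P3c · line LH6 «StCharTS» — THE VIRTUAL JACQUET-CHARACTER IDENTITY OVER «XIG» [Rogawski1990, Lemma 12.7.3 p. 195], by the SHELL ROAD (Casselman)
# (the export through which organs (S-i) ★ `F0P3cStCharTSNoncuspidalOfXIG` and (S-ii) `F0P3cStCharTSCuspidalOfXIG` run)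

Cell `hodgecm-mathlib`, squad F0∕P3b → line LH6 (P3c), seat LH6-p02 (g0); desk ruling 03:23:48Z «(S-i)∕(S-ii) carry ONE analytic socket = `hXIG` (St-form);
export the Jacquet-level consequence as `virtualJacquetIdentity_of_XIG`».  THEOREMS lane, sorry-free, `--supports stmt-HodgeConjecture-24833 --as helper`;
count-neutral.  Companion of ★ `F0P3cStCharTSNoncuspidalOfXIG` (organ (S-i) `stNoncuspidalMember_of_XIG` over the same `hXIG`).

WHAT.
* `virtualJacquetIdentity_of_XIG (hXIG)`: under the organ prefix of (S-i)∕(S-ii) through the square-integrability of the support (verbatim, `Pl`∕`HLoc`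
  spelled out), for the (β)-pair `(πp, πm)` with `aX = (1, −1)` and ANY representatives `rp, rm`: (1) eigencharacter multisets `sp, sm` of `π_N(rp)`, `π_N(rm)`
  on `T = (cmBorelTriple L 3 v).M` (`tr π_N(m) = Σ η(m)`) with `sp = sm + {δ_B^{1/2}·χ_ξ}` — the virtual Jacquet-character identity
  `tr r̄_B(rp) − tr r̄_B(rm) = χ_ξ` in its sharpest (multiset) form; (2) `dim V_N(rp) = dim V_N(rm) + 1`; (3) a non-zero `T`-map `r̄_B(rp) → ℂ_{χ_ξ}`.
* `stCuspidalMember_of_XIG (hXIG) : ‹type of stub_StCuspidalMember, tree `Cruxes/H413/Lines/F0_P3c_StCharTSPaydown.lean` ED. 1 :348–, VERBATIM›`: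
  from (2) and ★ «KEYS-JQ» (`π²` has a representative with a Jacquet LINE) the `−1` member has `V_N = 0`, i.e. is supercuspidal (★ N6).
The hypothesis `hXIG` («XIG-St» = [Rogawski1990, L.12.7.3 proof p. 195 display ⟸ Prop. 12.5.1 p. 183 + p. 193] + the shell hypothesis) is the ONE residual
named input: under the organ's prefix, for every Iwahori datum `𝓘` of ★ `cmBorelTriple L 3 v` whose ray `𝓘.a` reads `d(α, 1, (σ_w α)⁻¹)` (`0 < |α|_w < 1`)
in the one-place model, every central `z`, all deep levels `K_n` and `m ≥ 1`: a smooth `f^H` matched (Δ‴) with the shell `𝟙_{K_n (z·𝓘.aᵐ) K_n}` has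
`Tr St_H(ξ_v)(f^H) = ν(K_n) · [K_n : K_n ∩ ᵇK_n] · δ_B^{1/2}(b) · χ_ξ(b)`, `b = z·𝓘.aᵐ` (road (D), LH6-p04, multi-session).

PROOF ROAD (kernel-checked).  (1) Both members are admissible (★ N3), `dim V_N ≤ 2` (★ «JDIM2»), `tr π_N = Σ_s η` with quotient functionals (★ «TMULT»).
(2) For `b = z·a` (`z` central, `a` a contracting ray at any `w ∣ v`) the (T1) package ★ `exists_cmIwahoriDatum` + kit `dominant_central_mul` + ★ R2d +
★ «LEVEL-DEPTH» (kit `smoothTrace_shell_eq_mul_sum`) give `Tr π(𝟙_{K b K}) = ν(K)·#R·Σ_s η(b)` at deep level, while (β) (two-point support) + (T_v) + «XIG»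
give `Tr πp − Tr πm = ν(K)·#R·(δ^{1/2}χ_ξ)(b)`; cancelling, `Σ_{sp} η(b) − Σ_{sm} η(b) = (δ^{1/2}χ_ξ)(b)` on the cone.  (3) The cone at a fixed `w` is a
subsemigroup `B = Z(G)·{rays}` generating `T` (kit «TORUS-GEN»), so Artin WITH MULTIPLICITIES (§1, over ★ «ARTIN-B») gives `sp = sm + {δ^{1/2}χ_ξ}`;
hence (2) by ★ «TMULT»'s `card s = dim`, and (3) from the quotient functional of `δ^{1/2}χ_ξ ∈ sp` renormalised by `δ^{-1/2}` (kit).  (S-ii): `π² = πp`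
(coefficient `+1`), ★ «KEYS-JQ» gives a representative `r` of `π²` with `r̄_B(r) ≃ ℂ_χ` (dimension `1`), so by (2) `dim V_N(rm) = 0` for any representative
of `πm`, and ★ N6 `u3_isSupercuspidal_iff_jacquet_eq_zero_holds` concludes.
HONEST LABEL: conditional on «XIG» (named, vetted, owned by LH6-p04's road (D)); HC_CM is proved only modulo the 7 printed citations (2 remaining: hLiu418 =
stmt-HodgeConjecture-24832, h413 = stmt-HodgeConjecture-24833) until rung 0 closes.

## References
* [Rogawski1990] J. D. Rogawski, *Automorphic Representations of Unitary Groups in Three Variables*, Ann. of Math. Stud. 123 (1990), §12.5 Prop. 12.5.1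
  p. 183, §12.7 Lemma 12.7.3 p. 195, p. 193, §12.1 pp. 171–172.
* [Casselman1977] W. Casselman, *Characters and Jacquet modules*, Math. Ann. 230 (1977) 101–105, Thm. 5.2.
* [Casselman1995] W. Casselman, *Introduction to the theory of admissible representations of p-adic reductive groups* (1995 notes), §3.3, §4.1, Thm. 5.3.1.
* [BernsteinZelevinsky1977] I. N. Bernstein, A. V. Zelevinsky, *Induced representations of reductive p-adic groups I*, Ann. Sci. ÉNS 10 (1977), 2.9.
* [Lang2002] S. Lang, *Algebra*, 3rd ed., GTM 211 (2002), VI §4 Thm. 4.1.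
-/

set_option autoImplicit false
set_option linter.dupNamespace false

noncomputable section

open NumberField IsDedekindDomain MeasureTheory
open scoped Matrix MatrixGroups WithZero Topology Pointwise
open Literature.NumberTheory Literature.NumberTheory.Automorphic Literature.NumberTheory.Automorphic.UnitaryGroup
open Literature.NumberTheory.GaloisRepresentations
open Literature.NumberTheory.Rogawski1990

namespace Summit.HodgeConjecture.HodgeConjecture.Cruxes.H413.F0P3cStCharTSVirtualJacquetOfXIG

/-! ## §1 The virtual Jacquet-character identity over «XIG» (desk ruling 03:23:48Z: the ONE analytic socket of (S-i)∕(S-ii)) -/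

section Organ

set_option maxHeartbeats 8000000 in  -- statement-level `whnf` on the CM carriers (two copies of the organ prefix) + the long composition
set_option synthInstance.maxHeartbeats 400000 in
/-- **THE VIRTUAL JACQUET-CHARACTER IDENTITY OVER «XIG»** — [Rogawski1990, §12.7 proof of Lemma 12.7.3 p. 195: «by Proposition 12.5.1, `D_G(γ)χ^G_ρ(γ) =
ξ(γ)μ(α)‖α‖^{1∕2}` … which occurs with coefficient one and is the exponent of `π²(ξ)`»] on `U(Φ₃)(L⁺_v)`.  Under the prefix of organ (S-i) through the
square-integrability of the support (verbatim), given the pair `(πp, πm)` with `aX = (1, −1)`: for ANY representatives `rp, rm`,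
(1) the VIRTUAL JACQUET-CHARACTER IDENTITY in its sharpest form: the eigencharacter multisets `sp, sm` of `π_N(rp)`, `π_N(rm)` (`tr π_N(·)(m) = Σ_s η(m)` on
all of `T`) satisfy `sp = sm + {δ_B^{1/2}·χ_ξ}` — hence `tr r̄_B(rp)(m) − tr r̄_B(rm)(m) = χ_ξ(m)` on `T`; (2) `dim V_N(rp) = dim V_N(rm) + 1` (Artin with multiplicities: the eigencharacter
multisets differ exactly by `δ_B^{1/2}χ_ξ`); (3) a non-zero `T`-map `r̄_B(rp) → ℂ_{χ_ξ}`.  HYPOTHESIS `hXIG` («XIG-St»): under the organ's own prefix (verbatim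
through `hπ₁`), for every Iwahori datum `𝓘` of ★ `cmBorelTriple L 3 v` whose ray reads `d(α, 1, (σ_w α)⁻¹)`, `0 < |α|_w < 1`, in the one-place model, every
central `z`, there is a depth neighbourhood `U ∋ 1` such that at every level `K_n ⊆ U`, every `m ≥ 1`, every left transversal `R` of `K_n ∕ (K_n ∩ ᵇK_n)`
(`b = z·𝓘.aᵐ`) and every smooth `f^H` Δ‴-matched with the shell `𝟙_{K_n b K_n}`: `Tr πSt(f^H) = ν(K_n) · #R · δ_B^{1/2}(b) · χ_ξ(b)` — print's display read on
the shells; owned by LH6-p04's road (D), vetted «=» 03:03:25Z (sets∕transversals typed on the matrix carrier `U(Φ₃)(L⁺_v)`, defeq `Gqs L v`).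
Proof = ★ shell kit `F0P3cStCharTSShellKit` + ★ (T1) + ★ R2d + ★ «LEVEL-DEPTH» + ★ «JDIM2» + ★ «TMULT» + ★ «ARTIN-B» (module docstring).
[cite: Rogawski1990, Lemma 12.7.3 p. 195; Prop. 12.5.1 p. 183; §12.7 p. 193; §4.9 Prop. 4.9.1 (a) p. 55] [cite: Casselman1977, Thm. 5.2]
[cite: BernsteinZelevinsky1977, Thm. 2.9] -/
theorem virtualJacquetIdentity_of_XIG
    (hXIG :
      ∀ (L : Type) [Field L] [NumberField L] [IsCMField L] (μ : HeckeCharacter L) (ξ : OneDimAutRepH L) (v : HeightOneSpectrum (𝓞 ↥(maximalRealSubfield L))),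
        (∀ w : PlacesOver L v, IsCMField.complexConj L • w.1 = w.1) → μ.IsUnitary →
        (∀ x : Literature.NumberTheory.GaloisRepresentations.ideleGroup ↥(maximalRealSubfield L),
          μ (AdeleRing.ideleBaseChange (↥(maximalRealSubfield L)) L x) = quadraticHeckeCharCM L x) →
        ∀ [MeasurableSpace (((UnitaryGroup.cmDatum L 2 (Matrix.of fun i j : Fin 2 => if i.val + j.val + 1 = 2 then (1 : L) else 0)).Local v × (UnitaryGroup.cmDatum L 1 (Matrix.of fun i j : Fin 1 => if i.val + j.val + 1 = 1 then (1 : L) else 0)).Local v))] [BorelSpace (((UnitaryGroup.cmDatum L 2 (Matrix.of fun i j : Fin 2 => if i.val + j.val + 1 = 2 then (1 : L) else 0)).Local v × (UnitaryGroup.cmDatum L 1 (Matrix.of fun i j : Fin 1 => if i.val + j.val + 1 = 1 then (1 : L) else 0)).Local v))] [MeasurableSpace (Gqs L v)] [BorelSpace (Gqs L v)]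
          (νHv : Measure (((UnitaryGroup.cmDatum L 2 (Matrix.of fun i j : Fin 2 => if i.val + j.val + 1 = 2 then (1 : L) else 0)).Local v × (UnitaryGroup.cmDatum L 1 (Matrix.of fun i j : Fin 1 => if i.val + j.val + 1 = 1 then (1 : L) else 0)).Local v))) (νQv : Measure (Gqs L v))
          [νHv.IsHaarMeasure] [νHv.IsMulRightInvariant] [νQv.IsHaarMeasure] [νQv.IsMulRightInvariant],
        letI : ∀ a : ((UnitaryGroup.cmDatum L 2 (Matrix.of fun i j : Fin 2 => if i.val + j.val + 1 = 2 then (1 : L) else 0)).Local v × (UnitaryGroup.cmDatum L 1 (Matrix.of fun i j : Fin 1 => if i.val + j.val + 1 = 1 then (1 : L) else 0)).Local v), MeasurableSpace (((UnitaryGroup.cmDatum L 2 (Matrix.of fun i j : Fin 2 => if i.val + j.val + 1 = 2 then (1 : L) else 0)).Local v × (UnitaryGroup.cmDatum L 1 (Matrix.of fun i j : Fin 1 => if i.val + j.val + 1 = 1 then (1 : L) else 0)).Local v) ⧸ Subgroup.centralizer ({a} : Set (((UnitaryGroup.cmDatum L 2 (Matrix.of fun i j : Fin 2 => if i.val + j.val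 + 1 = 2 then (1 : L) else 0)).Local v × (UnitaryGroup.cmDatum L 1 (Matrix.of fun i j : Fin 1 => if i.val + j.val + 1 = 1 then (1 : L) else 0)).Local v)))) := fun _ => borel _
        haveI : ∀ a : ((UnitaryGroup.cmDatum L 2 (Matrix.of fun i j : Fin 2 => if i.val + j.val + 1 = 2 then (1 : L) else 0)).Local v × (UnitaryGroup.cmDatum L 1 (Matrix.of fun i j : Fin 1 => if i.val + j.val + 1 = 1 then (1 : L) else 0)).Local v), BorelSpace (((UnitaryGroup.cmDatum L 2 (Matrix.of fun i j : Fin 2 => if i.val + j.val + 1 = 2 then (1 : L) else 0)).Local v × (UnitaryGroup.cmDatum L 1 (Matrix.of fun i j : Fin 1 => if i.val + j.val + 1 = 1 then (1 : L) else 0)).Local v) ⧸ Subgroup.centralizer ({a} : Set (((UnitaryGroup.cmDatum L 2 (Matrix.of fun i j : Fin 2 => if i.val + j.val + 1 = 2 then (1 : L) else 0)).Local v × (UnitaryGroup.cmDatum L 1 (Matrix.of fun i j : Fin 1 => if i.val + j.val + 1 = 1 then (1 : L) else 0)).Local v)))) := fun _ => ⟨rfl⟩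
        letI : ∀ γ : Gqs L v, MeasurableSpace (Gqs L v ⧸ Subgroup.centralizer ({γ} : Set (Gqs L v))) := fun _ => borel _
        haveI : ∀ γ : Gqs L v, BorelSpace (Gqs L v ⧸ Subgroup.centralizer ({γ} : Set (Gqs L v))) := fun _ => ⟨rfl⟩
        ∀ (mHv : OrbitalMeasureFamily (((UnitaryGroup.cmDatum L 2 (Matrix.of fun i j : Fin 2 => if i.val + j.val + 1 = 2 then (1 : L) else 0)).Local v × (UnitaryGroup.cmDatum L 1 (Matrix.of fun i j : Fin 1 => if i.val + j.val + 1 = 1 then (1 : L) else 0)).Local v))) (mQv : OrbitalMeasureFamily (Gqs L v)),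
          mHv.IsCanonical (IsLocalGRegular L v) νHv →
          mQv.IsCanonical (fun γ => IsRegularElt (γ.val : GL (Fin 3) (UnitaryGroup.LocalRing L v))) νQv →
          IsLocalDeltaTransferExists L (qsForm L) v ((finExplicitCollection L (qsForm L) μ (finExplicitDelta_conj_left_all L (qsForm L) μ) (finExplicitDelta_conj_right_all L (qsForm L) μ)) v) mHv mQv IsLocSmooth IsLocSmooth →
          ∀ (π₁ πSt : IrrClass (((UnitaryGroup.cmDatum L 2 (Matrix.of fun i j : Fin 2 => if i.val + j.val + 1 = 2 then (1 : L) else 0)).Local v × (UnitaryGroup.cmDatum L 1 (Matrix.of fun i j : Fin 1 => if i.val + j.val + 1 = 1 then (1 : L) else 0)).Local v))),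
            HLengthTwoLabels L v
              (torusCharPair (conjLocal L (IsCMField.complexConj L) v) (cmLocalForm L 2 v) (cmLocalForm_eq_over L 2 v) 0
                ((torusLocalComponent L (IsCMField.complexConj L) v ξ.η).comp
                    (quotConj (conjLocal L (IsCMField.complexConj L) v) (conjLocal_conjLocal_cm L v)) *
                  halfModulusChar (UnitaryGroup.LocalRing L v))
                (torusLocalComponent L (IsCMField.complexConj L) v ξ.ψ))
              ((torusLocalComponent L (IsCMField.complexConj L) v ξ.ψ).comp (localDet (IsCMField.complexConj L) v (isUnit_antidiagOne_det L 1))) π₁ πSt →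
            (∀ fH : ((UnitaryGroup.cmDatum L 2 (Matrix.of fun i j : Fin 2 => if i.val + j.val + 1 = 2 then (1 : L) else 0)).Local v × (UnitaryGroup.cmDatum L 1 (Matrix.of fun i j : Fin 1 => if i.val + j.val + 1 = 1 then (1 : L) else 0)).Local v) → ℂ, IsLocSmooth fH → π₁.smoothTrace νHv fH = charDist (ξ.xiLocalChar v) νHv fH) →
          haveI := locallyCompactSpace_cmBorelU L 3 v
          ∀ (𝓘 : (cmBorelTriple L 3 v).IwahoriDatum) (z : ↥(unitaryGroupOfForm (conjLocal L (IsCMField.complexConj L) v) (cmLocalForm L 3 v))),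
            z ∈ Subgroup.center ↥(unitaryGroupOfForm (conjLocal L (IsCMField.complexConj L) v) (cmLocalForm L 3 v)) →
          ∀ (w : PlacesOver L v) (hw : IsCMField.complexConj L • w.1 = w.1) (α : w.1.adicCompletion L), α ≠ 0 → Valued.v α < 1 →
            ((((localNonsplitEquiv (IsCMField.complexConj L) (Rogawski1990.qsForm L) (IsCMField.complexConj_ne_one L) w hw) 𝓘.a : ↥(unitaryGroupOfForm (galAdicCompletionMap (L := L) (IsCMField.complexConj L) hw) (placeForm (Rogawski1990.qsForm L) w.1))) : GL (Fin 3) (w.1.adicCompletion L)) : Matrix (Fin 3) (Fin 3) (w.1.adicCompletion L)) = Matrix.diagonal ![α, 1, ((galAdicCompletionMap (L := L) (IsCMField.complexConj L) hw) α)⁻¹] →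
            ∃ U ∈ 𝓝 (1 : ↥(unitaryGroupOfForm (conjLocal L (IsCMField.complexConj L) v) (cmLocalForm L 3 v))), ∀ n : ℕ, ((𝓘.K n : Set ↥(unitaryGroupOfForm (conjLocal L (IsCMField.complexConj L) v) (cmLocalForm L 3 v))) ⊆ U) → ∀ m : ℕ, 1 ≤ m →
              ∀ (hbM : z * 𝓘.a ^ m ∈ (cmBorelTriple L 3 v).M) (R : Finset ↥(unitaryGroupOfForm (conjLocal L (IsCMField.complexConj L) v) (cmLocalForm L 3 v))),
                IsLeftTransversal (𝓘.K n) (𝓘.K n ⊓ ConjAct.toConjAct (z * 𝓘.a ^ m) • 𝓘.K n) R →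
                ∀ fH : ((UnitaryGroup.cmDatum L 2 (Matrix.of fun i j : Fin 2 => if i.val + j.val + 1 = 2 then (1 : L) else 0)).Local v × (UnitaryGroup.cmDatum L 1 (Matrix.of fun i j : Fin 1 => if i.val + j.val + 1 = 1 then (1 : L) else 0)).Local v) → ℂ, IsLocSmooth fH →
                  IsLocalDeltaTransfer L (qsForm L) v ((finExplicitCollection L (qsForm L) μ (finExplicitDelta_conj_left_all L (qsForm L) μ) (finExplicitDelta_conj_right_all L (qsForm L) μ)) v) mHv mQv fH
                    ((DoubleCoset.doubleCoset (z * 𝓘.a ^ m) (𝓘.K n : Set ↥(unitaryGroupOfForm (conjLocal L (IsCMField.complexConj L) v) (cmLocalForm L 3 v))) (𝓘.K n)).indicator fun _ => (1 : ℂ)) →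
                  πSt.smoothTrace νHv fH =
                    (νQv.real (𝓘.K n : Set ↥(unitaryGroupOfForm (conjLocal L (IsCMField.complexConj L) v) (cmLocalForm L 3 v))) : ℂ) * (R.card : ℂ) *
                      ((rootDeltaChar (cmBorelTriple L 3 v).P (Subgroup.inclusion (cmBorelTriple L 3 v).M_le ⟨z * 𝓘.a ^ m, hbM⟩) : ℂˣ) : ℂ) *
                      (((cmXiTorusChar L v (μ.semilocalComponent L v) (torusLocalComponent L (IsCMField.complexConj L) v ξ.η) (torusLocalComponent L (IsCMField.complexConj L) v ξ.ψ)) ⟨z * 𝓘.a ^ m, hbM⟩ : ℂˣ) : ℂ)) :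
  ∀ (L : Type) [Field L] [NumberField L] [IsCMField L] (μ : HeckeCharacter L) (ξ : OneDimAutRepH L) (v : HeightOneSpectrum (𝓞 ↥(maximalRealSubfield L))),
    (∀ w : PlacesOver L v, IsCMField.complexConj L • w.1 = w.1) → μ.IsUnitary →
    (∀ x : Literature.NumberTheory.GaloisRepresentations.ideleGroup ↥(maximalRealSubfield L),
      μ (AdeleRing.ideleBaseChange (↥(maximalRealSubfield L)) L x) = quadraticHeckeCharCM L x) →
    ∀ [MeasurableSpace (((UnitaryGroup.cmDatum L 2 (Matrix.of fun i j : Fin 2 => if i.val + j.val + 1 = 2 then (1 : L) else 0)).Local v × (UnitaryGroup.cmDatum L 1 (Matrix.of fun i j : Fin 1 => if i.val + j.val + 1 = 1 then (1 : L) else 0)).Local v))] [BorelSpace (((UnitaryGroup.cmDatum L 2 (Matrix.of fun i j : Fin 2 => if i.val + j.val + 1 = 2 then (1 : L) else 0)).Local v × (UnitaryGroup.cmDatum L 1 (Matrix.of fun i j : Fin 1 => if i.val + j.val + 1 = 1 then (1 : L) else 0)).Local v))] [MeasurableSpace (Gqs L v)] [BorelSpace (Gqs L v)]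
      (νHv : Measure (((UnitaryGroup.cmDatum L 2 (Matrix.of fun i j : Fin 2 => if i.val + j.val + 1 = 2 then (1 : L) else 0)).Local v × (UnitaryGroup.cmDatum L 1 (Matrix.of fun i j : Fin 1 => if i.val + j.val + 1 = 1 then (1 : L) else 0)).Local v))) (νQv : Measure (Gqs L v))
      [νHv.IsHaarMeasure] [νHv.IsMulRightInvariant] [νQv.IsHaarMeasure] [νQv.IsMulRightInvariant],
    letI : ∀ a : ((UnitaryGroup.cmDatum L 2 (Matrix.of fun i j : Fin 2 => if i.val + j.val + 1 = 2 then (1 : L) else 0)).Local v × (UnitaryGroup.cmDatum L 1 (Matrix.of fun i j : Fin 1 => if i.val + j.val + 1 = 1 then (1 : L) else 0)).Local v), MeasurableSpace (((UnitaryGroup.cmDatum L 2 (Matrix.of fun i j : Fin 2 => if i.val + j.val + 1 = 2 then (1 : L) else 0)).Local v × (UnitaryGroup.cmDatum L 1 (Matrix.of fun i j : Fin 1 => if i.val + j.val + 1 = 1 then (1 : L) else 0)).Local v) ⧸ Subgroup.centralizer ({a} : Set (((UnitaryGroup.cmDatum L 2 (Matrix.of fun i j : Fin 2 => if i.val + j.val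 + 1 = 2 then (1 : L) else 0)).Local v × (UnitaryGroup.cmDatum L 1 (Matrix.of fun i j : Fin 1 => if i.val + j.val + 1 = 1 then (1 : L) else 0)).Local v)))) := fun _ => borel _
    haveI : ∀ a : ((UnitaryGroup.cmDatum L 2 (Matrix.of fun i j : Fin 2 => if i.val + j.val + 1 = 2 then (1 : L) else 0)).Local v × (UnitaryGroup.cmDatum L 1 (Matrix.of fun i j : Fin 1 => if i.val + j.val + 1 = 1 then (1 : L) else 0)).Local v), BorelSpace (((UnitaryGroup.cmDatum L 2 (Matrix.of fun i j : Fin 2 => if i.val + j.val + 1 = 2 then (1 : L) else 0)).Local v × (UnitaryGroup.cmDatum L 1 (Matrix.of fun i j : Fin 1 => if i.val + j.val + 1 = 1 then (1 : L) else 0)).Local v) ⧸ Subgroup.centralizer ({a} : Set (((UnitaryGroup.cmDatum L 2 (Matrix.of fun i j : Fin 2 => if i.val + j.val + 1 = 2 then (1 : L) else 0)).Local v × (UnitaryGroup.cmDatum L 1 (Matrix.of fun i j : Fin 1 => if i.val + j.val + 1 = 1 then (1 : L) else 0)).Local v)))) := fun _ => ⟨rfl⟩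
    letI : ∀ γ : Gqs L v, MeasurableSpace (Gqs L v ⧸ Subgroup.centralizer ({γ} : Set (Gqs L v))) := fun _ => borel _
    haveI : ∀ γ : Gqs L v, BorelSpace (Gqs L v ⧸ Subgroup.centralizer ({γ} : Set (Gqs L v))) := fun _ => ⟨rfl⟩
    ∀ (mHv : OrbitalMeasureFamily (((UnitaryGroup.cmDatum L 2 (Matrix.of fun i j : Fin 2 => if i.val + j.val + 1 = 2 then (1 : L) else 0)).Local v × (UnitaryGroup.cmDatum L 1 (Matrix.of fun i j : Fin 1 => if i.val + j.val + 1 = 1 then (1 : L) else 0)).Local v))) (mQv : OrbitalMeasureFamily (Gqs L v)),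
      mHv.IsCanonical (IsLocalGRegular L v) νHv →
      mQv.IsCanonical (fun γ => IsRegularElt (γ.val : GL (Fin 3) (UnitaryGroup.LocalRing L v))) νQv →
      IsLocalDeltaTransferExists L (qsForm L) v ((finExplicitCollection L (qsForm L) μ (finExplicitDelta_conj_left_all L (qsForm L) μ) (finExplicitDelta_conj_right_all L (qsForm L) μ)) v) mHv mQv IsLocSmooth IsLocSmooth →
      ∀ (π₁ πSt : IrrClass (((UnitaryGroup.cmDatum L 2 (Matrix.of fun i j : Fin 2 => if i.val + j.val + 1 = 2 then (1 : L) else 0)).Local v × (UnitaryGroup.cmDatum L 1 (Matrix.of fun i j : Fin 1 => if i.val + j.val + 1 = 1 then (1 : L) else 0)).Local v))),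
        HLengthTwoLabels L v
          (torusCharPair (conjLocal L (IsCMField.complexConj L) v) (cmLocalForm L 2 v) (cmLocalForm_eq_over L 2 v) 0
            ((torusLocalComponent L (IsCMField.complexConj L) v ξ.η).comp
                (quotConj (conjLocal L (IsCMField.complexConj L) v) (conjLocal_conjLocal_cm L v)) *
              halfModulusChar (UnitaryGroup.LocalRing L v))
            (torusLocalComponent L (IsCMField.complexConj L) v ξ.ψ))
          ((torusLocalComponent L (IsCMField.complexConj L) v ξ.ψ).comp (localDet (IsCMField.complexConj L) v (isUnit_antidiagOne_det L 1))) π₁ πSt →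
        (∀ fH : ((UnitaryGroup.cmDatum L 2 (Matrix.of fun i j : Fin 2 => if i.val + j.val + 1 = 2 then (1 : L) else 0)).Local v × (UnitaryGroup.cmDatum L 1 (Matrix.of fun i j : Fin 1 => if i.val + j.val + 1 = 1 then (1 : L) else 0)).Local v) → ℂ, IsLocSmooth fH → π₁.smoothTrace νHv fH = charDist (ξ.xiLocalChar v) νHv fH) →
      ∀ [MeasurableSpace (Gqs L v ⧸ Subgroup.center (Gqs L v))] [BorelSpace (Gqs L v ⧸ Subgroup.center (Gqs L v))]
        (μZ : Measure (Gqs L v ⧸ Subgroup.center (Gqs L v))) [μZ.IsHaarMeasure],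
      ∀ aX : IrrClass (Gqs L v) → ℤ,
        (∀ (fH : ((UnitaryGroup.cmDatum L 2 (Matrix.of fun i j : Fin 2 => if i.val + j.val + 1 = 2 then (1 : L) else 0)).Local v × (UnitaryGroup.cmDatum L 1 (Matrix.of fun i j : Fin 1 => if i.val + j.val + 1 = 1 then (1 : L) else 0)).Local v) → ℂ) (φ : Gqs L v → ℂ), IsLocSmooth fH → IsLocSmooth φ →
            IsLocalDeltaTransfer L (qsForm L) v ((finExplicitCollection L (qsForm L) μ (finExplicitDelta_conj_left_all L (qsForm L) μ) (finExplicitDelta_conj_right_all L (qsForm L) μ)) v) mHv mQv fH φ →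
            Summable (fun π : IrrClass (Gqs L v) => (aX π : ℂ) * π.smoothTrace νQv φ) ∧
              ∑' π : IrrClass (Gqs L v), (aX π : ℂ) * π.smoothTrace νQv φ = πSt.smoothTrace νHv fH) →
        ∀ (πp πm : IrrClass (Gqs L v)), πp ≠ πm → Function.support aX = {πp, πm} → aX πp = 1 → aX πm = -1 →
        (∀ π : IrrClass (Gqs L v), aX π ≠ 0 → π.IsSquareIntegrable μZ) →
      ∀ (rp rm : SmoothIrrep (Gqs L v)), IrrClass.mk rp = πp → IrrClass.mk rm = πm →
      haveI := locallyCompactSpace_cmBorelU L 3 v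
      (∃ sp sm : Multiset (↥(cmBorelTriple L 3 v).M →* ℂˣ),
        (∀ m : ↥(cmBorelTriple L 3 v).M, LinearMap.trace ℂ _ (Representation.jacquetModule (G := ↥(unitaryGroupOfForm (conjLocal L (IsCMField.complexConj L) v) (cmLocalForm L 3 v))) rp.ρ (cmBorelTriple L 3 v) m) =
          (sp.map fun η : ↥(cmBorelTriple L 3 v).M →* ℂˣ => ((η m : ℂˣ) : ℂ)).sum) ∧
        (∀ m : ↥(cmBorelTriple L 3 v).M, LinearMap.trace ℂ _ (Representation.jacquetModule (G := ↥(unitaryGroupOfForm (conjLocal L (IsCMField.complexConj L) v) (cmLocalForm L 3 v))) rm.ρ (cmBorelTriple L 3 v) m) =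
          (sm.map fun η : ↥(cmBorelTriple L 3 v).M →* ℂˣ => ((η m : ℂˣ) : ℂ)).sum) ∧
        sp = sm + {((rootDeltaChar (cmBorelTriple L 3 v).P).comp (Subgroup.inclusion (cmBorelTriple L 3 v).M_le)) * (cmXiTorusChar L v (μ.semilocalComponent L v) (torusLocalComponent L (IsCMField.complexConj L) v ξ.η) (torusLocalComponent L (IsCMField.complexConj L) v ξ.ψ))}) ∧
      Module.finrank ℂ ((cmBorelTriple L 3 v).restrict rp.ρ).Coinvariants = Module.finrank ℂ ((cmBorelTriple L 3 v).restrict rm.ρ).Coinvariants + 1 ∧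
      ∃ ψ : (rp.ρ.normalizedJacquet (cmBorelTriple L 3 v)).IntertwiningMap ((Representation.trivial ℂ ↥(torusU (conjLocal L (IsCMField.complexConj L) v) (cmLocalForm L 3 v)) ℂ).twist (cmXiTorusChar L v (μ.semilocalComponent L v) (torusLocalComponent L (IsCMField.complexConj L) v ξ.η) (torusLocalComponent L (IsCMField.complexConj L) v ξ.ψ))), ψ ≠ 0 := by
  intro L _ _ _ μ ξ v hns hμu hμω _ _ _ _ νHv νQv _ _ _ _ mHv mQv hcH hcQ hTv π₁ πSt hlab hπ₁ _ _ μZ _ aX hid πp πm hne hsupp hp1 hm1 _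
    rp rm hrp hrm
  -- the statement's Borel structures on the centraliser quotients, re-declared for instance search (as in the leaf's `QST_of_organs`)
  letI : ∀ a' : ((UnitaryGroup.cmDatum L 2 (Matrix.of fun i j : Fin 2 => if i.val + j.val + 1 = 2 then (1 : L) else 0)).Local v × (UnitaryGroup.cmDatum L 1 (Matrix.of fun i j : Fin 1 => if i.val + j.val + 1 = 1 then (1 : L) else 0)).Local v),
      MeasurableSpace (((UnitaryGroup.cmDatum L 2 (Matrix.of fun i j : Fin 2 => if i.val + j.val + 1 = 2 then (1 : L) else 0)).Local v × (UnitaryGroup.cmDatum L 1 (Matrix.of fun i j : Fin 1 => if i.val + j.val + 1 = 1 then (1 : L) else 0)).Local v) ⧸ Subgroup.centralizer ({a'} : Set ((UnitaryGroup.cmDatum L 2 (Matrix.of fun i j : Fin 2 => if i.val + j.val + 1 = 2 then (1 : L) else 0)).Local v × (UnitaryGroup.cmDatum L 1 (Matrix.of fun i j : Fin 1 => if i.val + j.val + 1 = 1 then (1 : L) else 0)).Local v))) := fun _ => borel _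
  haveI : ∀ a' : ((UnitaryGroup.cmDatum L 2 (Matrix.of fun i j : Fin 2 => if i.val + j.val + 1 = 2 then (1 : L) else 0)).Local v × (UnitaryGroup.cmDatum L 1 (Matrix.of fun i j : Fin 1 => if i.val + j.val + 1 = 1 then (1 : L) else 0)).Local v),
      BorelSpace (((UnitaryGroup.cmDatum L 2 (Matrix.of fun i j : Fin 2 => if i.val + j.val + 1 = 2 then (1 : L) else 0)).Local v × (UnitaryGroup.cmDatum L 1 (Matrix.of fun i j : Fin 1 => if i.val + j.val + 1 = 1 then (1 : L) else 0)).Local v) ⧸ Subgroup.centralizer ({a'} : Set ((UnitaryGroup.cmDatum L 2 (Matrix.of fun i j : Fin 2 => if i.val + j.val + 1 = 2 then (1 : L) else 0)).Local v × (UnitaryGroup.cmDatum L 1 (Matrix.of fun i j : Fin 1 => if i.val + j.val + 1 = 1 then (1 : L) else 0)).Local v))) := fun _ => ⟨rfl⟩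
  letI : ∀ γ : Gqs L v, MeasurableSpace (Gqs L v ⧸ Subgroup.centralizer ({γ} : Set (Gqs L v))) := fun _ => borel _
  haveI : ∀ γ : Gqs L v, BorelSpace (Gqs L v ⧸ Subgroup.centralizer ({γ} : Set (Gqs L v))) := fun _ => ⟨rfl⟩
  haveI := locallyCompactSpace_cmBorelU L 3 v
  haveI : LocallyCompactSpace (Gqs L v) := locallyCompactSpace_cmDatum_local (L := L) (N := 3) (H := qsForm L) (v := v)
  refine (inferInstance : Nonempty (PlacesOver L v)).elim fun w => ?_
  have hw : IsCMField.complexConj L • w.1 = w.1 := hns w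
  -- the one-place model at `w`, read on the CM carrier
  -- (top-level destructurings are spelled with `Exists.elim`∕projections: `rcases` against this large goal is prohibitively slow)
  refine Exists.elim (⟨_, rfl⟩ : ∃ e : ↥(unitaryGroupOfForm (conjLocal L (IsCMField.complexConj L) v) (cmLocalForm L 3 v)) ≃ₜ* ↥(unitaryGroupOfForm (galAdicCompletionMap (L := L) (IsCMField.complexConj L) hw) (placeForm (Rogawski1990.qsForm L) w.1)),
      e = localNonsplitEquiv (IsCMField.complexConj L) (Rogawski1990.qsForm L) (IsCMField.complexConj_ne_one L) w hw) fun e he => ?_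
  -- the organ's measure-theoretic structures on the model `Gqs L v`, re-read on the (definitionally equal) matrix carrier `U(Φ₃)(L⁺_v)`;
  -- canonical instances pinned once (the generic lemmas are applied with `@` so that unification with `cmBorelTriple`∕`ρ` cannot
  -- pre-assign instance arguments along a different (defeq) path)
  letI mU : MeasurableSpace ↥(unitaryGroupOfForm (conjLocal L (IsCMField.complexConj L) v) (cmLocalForm L 3 v)) := ‹MeasurableSpace (Gqs L v)›
  haveI : BorelSpace ↥(unitaryGroupOfForm (conjLocal L (IsCMField.complexConj L) v) (cmLocalForm L 3 v)) := ‹BorelSpace (Gqs L v)›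
  have iTG : IsTopologicalGroup ↥(unitaryGroupOfForm (conjLocal L (IsCMField.complexConj L) v) (cmLocalForm L 3 v)) := inferInstance
  have iML : (νQv : Measure ↥(unitaryGroupOfForm (conjLocal L (IsCMField.complexConj L) v) (cmLocalForm L 3 v))).IsMulLeftInvariant := inferInstance
  have iFC : IsFiniteMeasureOnCompacts (νQv : Measure ↥(unitaryGroupOfForm (conjLocal L (IsCMField.complexConj L) v) (cmLocalForm L 3 v))) := inferInstance
  /- STEP 1 — admissibility (★ N3 on `U(Φ₃)`); `dim V_N ≤ 2` («JDIM2»); eigencharacter multisets («TMULT»). -/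
  have hadm : ∀ c : IrrClass (Gqs L v), c.IsAdmissible := fun c =>
    F0P3LocalIrrepAdmissibleOfCuspidal.isAdmissible_irrClass_quasiSplit_of_cuspidal L v
      (F0P3LocalIrrepAdmissibleThree.isSupercuspidal_of_subsingleton_coinvariants L v hns) c
  let ρp : Representation ℂ ↥(unitaryGroupOfForm (conjLocal L (IsCMField.complexConj L) v) (cmLocalForm L 3 v)) rp.V := rp.ρ
  let ρm : Representation ℂ ↥(unitaryGroupOfForm (conjLocal L (IsCMField.complexConj L) v) (cmLocalForm L 3 v)) rm.V := rm.ρ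
  have hap : ρp.IsAdmissible := (IrrClass.isAdmissible_mk rp).1 (hadm _)
  have ham : ρm.IsAdmissible := (IrrClass.isAdmissible_mk rm).1 (hadm _)
  have hfdp := (F0P3cStCharTSJacquetLine.finrank_coinvariants_le_two L v hns rp).1
  have h2p := (F0P3cStCharTSJacquetLine.finrank_coinvariants_le_two L v hns rp).2
  have hfdm := (F0P3cStCharTSJacquetLine.finrank_coinvariants_le_two L v hns rm).1
  have h2m := (F0P3cStCharTSJacquetLine.finrank_coinvariants_le_two L v hns rm).2
  have hTcomm : ∀ a b : ↥(cmBorelTriple L 3 v).M, a * b = b * a := fun a b => torusU_mul_comm _ _ a b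
  refine (@F0P3cStCharTSTorusMultiset.exists_multiset_of_finrank_le_two _ _ _ _ _ hfdp
    (ρp.jacquetModule (cmBorelTriple L 3 v)) (fun a b => hTcomm a b) h2p).elim fun sp hsp3 => ?_
  have hcp := hsp3.1
  have hsp := hsp3.2.1
  have hfp := hsp3.2.2
  refine (@F0P3cStCharTSTorusMultiset.exists_multiset_of_finrank_le_two _ _ _ _ _ hfdm
    (ρm.jacquetModule (cmBorelTriple L 3 v)) (fun a b => hTcomm a b) h2m).elim fun sm hsm3 => ?_
  have hcm := hsm3.1
  have hsm := hsm3.2.1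
  -- the target eigencharacter `θ_ξ = δ_B^{1/2} · χ_ξ` of `π_N(π²)` (print: `D_G χ^G_ρ = ξμ‖α‖^{1/2}`, p. 195)
  refine Exists.elim (⟨_, rfl⟩ : ∃ θ : ↥(cmBorelTriple L 3 v).M →* ℂˣ,
      θ = ((rootDeltaChar (cmBorelTriple L 3 v).P).comp (Subgroup.inclusion (cmBorelTriple L 3 v).M_le)) * (cmXiTorusChar L v (μ.semilocalComponent L v) (torusLocalComponent L (IsCMField.complexConj L) v ξ.η) (torusLocalComponent L (IsCMField.complexConj L) v ξ.ψ))) fun θξ hθξ => ?_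
  have hθχ : ∀ m : ↥(cmBorelTriple L 3 v).M, θξ m = rootDeltaChar (cmBorelTriple L 3 v).P (Subgroup.inclusion (cmBorelTriple L 3 v).M_le m) * (cmXiTorusChar L v (μ.semilocalComponent L v) (torusLocalComponent L (IsCMField.complexConj L) v ξ.η) (torusLocalComponent L (IsCMField.complexConj L) v ξ.ψ)) m :=
    fun m => by rw [hθξ, MonoidHom.mul_apply, MonoidHom.comp_apply]
  /- STEP 2 — the subsemigroup `B = Z(G)·{contracting rays at w}` of `T`; it generates `T` («TORUS-GEN»); it lies in the cone. -/
  have hBex : ∃ B : Subsemigroup ↥(cmBorelTriple L 3 v).M, (B : Set ↥(cmBorelTriple L 3 v).M) =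
      {t : ↥(cmBorelTriple L 3 v).M | ∃ z : ↥(unitaryGroupOfForm (conjLocal L (IsCMField.complexConj L) v) (cmLocalForm L 3 v)), z ∈ Subgroup.center ↥(unitaryGroupOfForm (conjLocal L (IsCMField.complexConj L) v) (cmLocalForm L 3 v)) ∧ z ∈ (cmBorelTriple L 3 v).M ∧
        ∃ (a : ↥(torusU (conjLocal L (IsCMField.complexConj L) v) (cmLocalForm L 3 v))) (α : w.1.adicCompletion L), α ≠ 0 ∧ Valued.v α < 1 ∧
          (((e (a : ↥(unitaryGroupOfForm (conjLocal L (IsCMField.complexConj L) v) (cmLocalForm L 3 v))) : ↥(unitaryGroupOfForm (galAdicCompletionMap (L := L) (IsCMField.complexConj L) hw) (placeForm (Rogawski1990.qsForm L) w.1))) : GL (Fin 3) (w.1.adicCompletion L)) : Matrix (Fin 3) (Fin 3) (w.1.adicCompletion L)) = Matrix.diagonal ![α, 1, ((galAdicCompletionMap (L := L) (IsCMField.complexConj L) hw) α)⁻¹] ∧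
          (t : ↥(unitaryGroupOfForm (conjLocal L (IsCMField.complexConj L) v) (cmLocalForm L 3 v))) = z * (a : ↥(unitaryGroupOfForm (conjLocal L (IsCMField.complexConj L) v) (cmLocalForm L 3 v)))} := by
    refine ⟨{ carrier := _, mul_mem' := ?_ }, rfl⟩
    rintro t₁ t₂ ⟨z₁, hz₁c, hz₁M, a₁, α₁, hα₁0, hα₁1, hE₁, ht₁⟩ ⟨z₂, hz₂c, hz₂M, a₂, α₂, hα₂0, hα₂1, hE₂, ht₂⟩
    refine ⟨z₁ * z₂, Subgroup.mul_mem _ hz₁c hz₂c, Subgroup.mul_mem _ hz₁M hz₂M, a₁ * a₂, α₁ * α₂, mul_ne_zero hα₁0 hα₂0, ?_, ?_, ?_⟩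
    · rw [map_mul]; exact mul_lt_one_of_nonneg_of_lt_one_left zero_le hα₁1 hα₂1.le
    · rw [Subgroup.coe_mul, map_mul, Subgroup.coe_mul, Units.val_mul, hE₁, hE₂, Matrix.diagonal_mul_diagonal, map_mul, mul_inv]
      congr 1
      funext i
      fin_cases i <;> simp
    · show (t₁ : ↥(unitaryGroupOfForm (conjLocal L (IsCMField.complexConj L) v) (cmLocalForm L 3 v))) * (t₂ : ↥(unitaryGroupOfForm (conjLocal L (IsCMField.complexConj L) v) (cmLocalForm L 3 v))) = z₁ * z₂ * ((a₁ : ↥(unitaryGroupOfForm (conjLocal L (IsCMField.complexConj L) v) (cmLocalForm L 3 v))) * (a₂ : ↥(unitaryGroupOfForm (conjLocal L (IsCMField.complexConj L) v) (cmLocalForm L 3 v))))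
      have hc : (a₁ : ↥(unitaryGroupOfForm (conjLocal L (IsCMField.complexConj L) v) (cmLocalForm L 3 v))) * z₂ = z₂ * (a₁ : ↥(unitaryGroupOfForm (conjLocal L (IsCMField.complexConj L) v) (cmLocalForm L 3 v))) := Subgroup.mem_center_iff.1 hz₂c _
      rw [ht₁, ht₂, mul_assoc, mul_assoc, ← mul_assoc (a₁ : ↥(unitaryGroupOfForm (conjLocal L (IsCMField.complexConj L) v) (cmLocalForm L 3 v))) z₂, hc, mul_assoc]
  refine hBex.elim fun B hBdef => ?_
  have hmemB : ∀ t : ↥(cmBorelTriple L 3 v).M, t ∈ B ↔ ∃ z : ↥(unitaryGroupOfForm (conjLocal L (IsCMField.complexConj L) v) (cmLocalForm L 3 v)), z ∈ Subgroup.center ↥(unitaryGroupOfForm (conjLocal L (IsCMField.complexConj L) v) (cmLocalForm L 3 v)) ∧ z ∈ (cmBorelTriple L 3 v).M ∧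
        ∃ (a : ↥(torusU (conjLocal L (IsCMField.complexConj L) v) (cmLocalForm L 3 v))) (α : w.1.adicCompletion L), α ≠ 0 ∧ Valued.v α < 1 ∧
          (((e (a : ↥(unitaryGroupOfForm (conjLocal L (IsCMField.complexConj L) v) (cmLocalForm L 3 v))) : ↥(unitaryGroupOfForm (galAdicCompletionMap (L := L) (IsCMField.complexConj L) hw) (placeForm (Rogawski1990.qsForm L) w.1))) : GL (Fin 3) (w.1.adicCompletion L)) : Matrix (Fin 3) (Fin 3) (w.1.adicCompletion L)) = Matrix.diagonal ![α, 1, ((galAdicCompletionMap (L := L) (IsCMField.complexConj L) hw) α)⁻¹] ∧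
          (t : ↥(unitaryGroupOfForm (conjLocal L (IsCMField.complexConj L) v) (cmLocalForm L 3 v))) = z * (a : ↥(unitaryGroupOfForm (conjLocal L (IsCMField.complexConj L) v) (cmLocalForm L 3 v))) := fun t => by
    rw [← SetLike.mem_coe, hBdef, Set.mem_setOf_eq]
  have hB : Subgroup.closure (B : Set ↥(cmBorelTriple L 3 v).M) = ⊤ := by
    rw [eq_top_iff]
    rintro t -
    obtain ⟨z, a₁, a₂, α₁, α₂, hzc, hzM, hα₁0, hα₁1, hE₁, hα₂0, hα₂1, hE₂, ht⟩ :=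
      F0P3cStCharTSShellKit.cm_torus_eq_central_mul_ray_mul_ray_inv L v w hw t
    have h₁ : (⟨z * (a₁ : ↥(unitaryGroupOfForm (conjLocal L (IsCMField.complexConj L) v) (cmLocalForm L 3 v))), (cmBorelTriple L 3 v).M.mul_mem hzM a₁.2⟩ : ↥(cmBorelTriple L 3 v).M) ∈ B :=
      (hmemB _).2 ⟨z, hzc, hzM, a₁, α₁, hα₁0, hα₁1, by rw [he]; exact hE₁, rfl⟩
    have h₂ : (⟨(a₂ : ↥(unitaryGroupOfForm (conjLocal L (IsCMField.complexConj L) v) (cmLocalForm L 3 v))), a₂.2⟩ : ↥(cmBorelTriple L 3 v).M) ∈ B :=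
      (hmemB _).2 ⟨1, Subgroup.one_mem _, Subgroup.one_mem _, a₂, α₂, hα₂0, hα₂1, by rw [he]; exact hE₂, (one_mul _).symm⟩
    have ht' : t = (⟨z * (a₁ : ↥(unitaryGroupOfForm (conjLocal L (IsCMField.complexConj L) v) (cmLocalForm L 3 v))), (cmBorelTriple L 3 v).M.mul_mem hzM a₁.2⟩ : ↥(cmBorelTriple L 3 v).M) * (⟨(a₂ : ↥(unitaryGroupOfForm (conjLocal L (IsCMField.complexConj L) v) (cmLocalForm L 3 v))), a₂.2⟩ : ↥(cmBorelTriple L 3 v).M)⁻¹ :=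
      Subtype.ext ht
    rw [ht']
    exact Subgroup.mul_mem _ (Subgroup.subset_closure h₁) (Subgroup.inv_mem _ (Subgroup.subset_closure h₂))
  have hne' : ∃ b, b ∈ B := by
    obtain ⟨z, a₁, a₂, α₁, α₂, hzc, hzM, hα₁0, hα₁1, hE₁, -, -, -, -⟩ := F0P3cStCharTSShellKit.cm_torus_eq_central_mul_ray_mul_ray_inv L v w hw 1
    exact ⟨⟨z * (a₁ : ↥(unitaryGroupOfForm (conjLocal L (IsCMField.complexConj L) v) (cmLocalForm L 3 v))), (cmBorelTriple L 3 v).M.mul_mem hzM a₁.2⟩,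
      (hmemB _).2 ⟨z, hzc, hzM, a₁, α₁, hα₁0, hα₁1, by rw [he]; exact hE₁, rfl⟩⟩
  have hBcone : ∀ t : ↥(cmBorelTriple L 3 v).M, t ∈ B → ∃ z : ↥(unitaryGroupOfForm (conjLocal L (IsCMField.complexConj L) v) (cmLocalForm L 3 v)), z ∈ Subgroup.center ↥(unitaryGroupOfForm (conjLocal L (IsCMField.complexConj L) v) (cmLocalForm L 3 v)) ∧ z ∈ (cmBorelTriple L 3 v).M ∧
            ∃ (a : ↥(torusU (conjLocal L (IsCMField.complexConj L) v) (cmLocalForm L 3 v))) (w : PlacesOver L v) (hw : IsCMField.complexConj L • w.1 = w.1) (α : w.1.adicCompletion L), α ≠ 0 ∧ Valued.v α < 1 ∧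
              ((((localNonsplitEquiv (IsCMField.complexConj L) (Rogawski1990.qsForm L) (IsCMField.complexConj_ne_one L) w hw) (a : ↥(unitaryGroupOfForm (conjLocal L (IsCMField.complexConj L) v) (cmLocalForm L 3 v))) : ↥(unitaryGroupOfForm (galAdicCompletionMap (L := L) (IsCMField.complexConj L) hw) (placeForm (Rogawski1990.qsForm L) w.1))) : GL (Fin 3) (w.1.adicCompletion L)) : Matrix (Fin 3) (Fin 3) (w.1.adicCompletion L)) = Matrix.diagonal ![α, 1, ((galAdicCompletionMap (L := L) (IsCMField.complexConj L) hw) α)⁻¹] ∧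
              (t : ↥(unitaryGroupOfForm (conjLocal L (IsCMField.complexConj L) v) (cmLocalForm L 3 v))) = z * (a : ↥(unitaryGroupOfForm (conjLocal L (IsCMField.complexConj L) v) (cmLocalForm L 3 v))) := by
    intro t ht
    obtain ⟨z, hzc, hzM, a, α, hα0, hα1, hEa, hta⟩ := (hmemB t).1 ht
    rw [he] at hEa
    exact ⟨z, hzc, hzM, a, w, hw, α, hα0, hα1, hEa, hta⟩
  /- STEP 3 — the shell identity on the cone: `Σ_{sp} θ(b) − Σ_{sm} θ(b) = θ_ξ(b)` ((β) at the shell `𝟙_{K_n b K_n}` vs ★ R2d + «LEVEL-DEPTH» + «XIG»). -/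
  have hmain : ∀ b : ↥(cmBorelTriple L 3 v).M, (∃ z : ↥(unitaryGroupOfForm (conjLocal L (IsCMField.complexConj L) v) (cmLocalForm L 3 v)), z ∈ Subgroup.center ↥(unitaryGroupOfForm (conjLocal L (IsCMField.complexConj L) v) (cmLocalForm L 3 v)) ∧ z ∈ (cmBorelTriple L 3 v).M ∧
            ∃ (a : ↥(torusU (conjLocal L (IsCMField.complexConj L) v) (cmLocalForm L 3 v))) (w : PlacesOver L v) (hw : IsCMField.complexConj L • w.1 = w.1) (α : w.1.adicCompletion L), α ≠ 0 ∧ Valued.v α < 1 ∧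
              ((((localNonsplitEquiv (IsCMField.complexConj L) (Rogawski1990.qsForm L) (IsCMField.complexConj_ne_one L) w hw) (a : ↥(unitaryGroupOfForm (conjLocal L (IsCMField.complexConj L) v) (cmLocalForm L 3 v))) : ↥(unitaryGroupOfForm (galAdicCompletionMap (L := L) (IsCMField.complexConj L) hw) (placeForm (Rogawski1990.qsForm L) w.1))) : GL (Fin 3) (w.1.adicCompletion L)) : Matrix (Fin 3) (Fin 3) (w.1.adicCompletion L)) = Matrix.diagonal ![α, 1, ((galAdicCompletionMap (L := L) (IsCMField.complexConj L) hw) α)⁻¹] ∧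
              (b : ↥(unitaryGroupOfForm (conjLocal L (IsCMField.complexConj L) v) (cmLocalForm L 3 v))) = z * (a : ↥(unitaryGroupOfForm (conjLocal L (IsCMField.complexConj L) v) (cmLocalForm L 3 v)))) →
      (sp.map fun η : ↥(cmBorelTriple L 3 v).M →* ℂˣ => ((η b : ℂˣ) : ℂ)).sum - (sm.map fun η : ↥(cmBorelTriple L 3 v).M →* ℂˣ => ((η b : ℂˣ) : ℂ)).sum = ((θξ b : ℂˣ) : ℂ) := by
    intro b hb
    obtain ⟨z, hzc, hzM, a, w', hw', α, hα0, hα1, hEa, hba⟩ := hb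
    -- (T1) along the ray `a`; `b = z·𝓘.a` is dominant at every level
    obtain ⟨𝓘, K₀, ha𝓘, -, -, -, -, -, haN, haNbar, hexh, -, -, -⟩ :=
      F0P3CMBorelIwahoriDatum.exists_cmIwahoriDatum L v w' hw' a hα0 hα1 hEa
    have hE𝓘 : ((((localNonsplitEquiv (IsCMField.complexConj L) (Rogawski1990.qsForm L) (IsCMField.complexConj_ne_one L) w' hw') 𝓘.a : ↥(unitaryGroupOfForm (galAdicCompletionMap (L := L) (IsCMField.complexConj L) hw') (placeForm (Rogawski1990.qsForm L) w'.1))) : GL (Fin 3) (w'.1.adicCompletion L)) : Matrix (Fin 3) (Fin 3) (w'.1.adicCompletion L)) = Matrix.diagonal ![α, 1, ((galAdicCompletionMap (L := L) (IsCMField.complexConj L) hw') α)⁻¹] := by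
      rw [ha𝓘]; exact hEa
    have hb𝓘 : (b : ↥(unitaryGroupOfForm (conjLocal L (IsCMField.complexConj L) v) (cmLocalForm L 3 v))) = z * 𝓘.a := by rw [ha𝓘]; exact hba
    have hbM' : z * 𝓘.a ∈ (cmBorelTriple L 3 v).M := (cmBorelTriple L 3 v).M.mul_mem hzM 𝓘.a_mem
    have hbeq : b = ⟨z * 𝓘.a, hbM'⟩ := Subtype.ext hb𝓘
    have hbcomm : ∀ m ∈ (cmBorelTriple L 3 v).M, m * (z * 𝓘.a) = z * 𝓘.a * m := fun m hm =>
      congrArg Subtype.val (hTcomm ⟨m, hm⟩ ⟨z * 𝓘.a, hbM'⟩)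
    obtain ⟨hbN, hbNbar, hbexh⟩ := F0P3cStCharTSShellKit.dominant_central_mul (cmBorelTriple L 3 v) 𝓘 hzc haN haNbar hexh
    -- «XIG» along `(𝓘, z)`; ★ R2d + «LEVEL-DEPTH» for the two members of the support
    obtain ⟨UX, hUX, hX⟩ := hXIG L μ ξ v hns hμu hμω νHv νQv mHv mQv hcH hcQ hTv π₁ πSt hlab hπ₁ 𝓘 z hzc w' hw' α hα0 hα1 hE𝓘
    obtain ⟨Up, hUp, hAp⟩ := @F0P3cStCharTSShellKit.smoothTrace_shell_eq_mul_sum ↥(unitaryGroupOfForm (conjLocal L (IsCMField.complexConj L) v) (cmLocalForm L 3 v)) inferInstance inferInstance iTG mU inferInstance νQv iML iFC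
      _ _ _ ρp hap (cmBorelTriple L 3 v) (isClosed_cmBorelTriple_N L v) 𝓘 hfdp sp hsp (z * 𝓘.a) hbM' hbcomm hbN hbNbar hbexh
    obtain ⟨Um, hUm, hAm⟩ := @F0P3cStCharTSShellKit.smoothTrace_shell_eq_mul_sum ↥(unitaryGroupOfForm (conjLocal L (IsCMField.complexConj L) v) (cmLocalForm L 3 v)) inferInstance inferInstance iTG mU inferInstance νQv iML iFC
      _ _ _ ρm ham (cmBorelTriple L 3 v) (isClosed_cmBorelTriple_N L v) 𝓘 hfdm sm hsm (z * 𝓘.a) hbM' hbcomm hbN hbNbar hbexh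
    -- one level inside the three depth neighbourhoods; a transversal; the shell is a test function; its transfer (T_v)
    obtain ⟨n, hn⟩ := 𝓘.hasBasis_K (UX ∩ (Up ∩ Um)) (Filter.inter_mem hUX (Filter.inter_mem hUp hUm))
    have hnX : (𝓘.K n : Set ↥(unitaryGroupOfForm (conjLocal L (IsCMField.complexConj L) v) (cmLocalForm L 3 v))) ⊆ UX := hn.trans Set.inter_subset_left
    have hnp : (𝓘.K n : Set ↥(unitaryGroupOfForm (conjLocal L (IsCMField.complexConj L) v) (cmLocalForm L 3 v))) ⊆ Up := hn.trans (Set.inter_subset_right.trans Set.inter_subset_left)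
    have hnm : (𝓘.K n : Set ↥(unitaryGroupOfForm (conjLocal L (IsCMField.complexConj L) v) (cmLocalForm L 3 v))) ⊆ Um := hn.trans (Set.inter_subset_right.trans Set.inter_subset_right)
    have hKo := 𝓘.isOpen_K n
    have hKc := 𝓘.isCompact_K n
    obtain ⟨R, hR⟩ := Representation.exists_isLeftTransversal_conj hKc hKo (z * 𝓘.a)
    have hφ : IsLocSmooth ((DoubleCoset.doubleCoset (z * 𝓘.a) (𝓘.K n : Set ↥(unitaryGroupOfForm (conjLocal L (IsCMField.complexConj L) v) (cmLocalForm L 3 v))) (𝓘.K n)).indicator fun _ => (1 : ℂ)) := by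
      have hc : IsCompact (DoubleCoset.doubleCoset (z * 𝓘.a) (𝓘.K n : Set ↥(unitaryGroupOfForm (conjLocal L (IsCMField.complexConj L) v) (cmLocalForm L 3 v))) (𝓘.K n)) :=
        DoubleCosetIndex.isCompact_doubleCoset hKc _
      refine isLocSmooth_indicator ?_ hc.isClosed hc
      unfold DoubleCoset.doubleCoset
      exact (hKo.mul_right).mul_right
    obtain ⟨fH, hfH, htr⟩ := hTv _ hφ
    -- (β) at `(fH, φ)`: the two-point sum `Tr πp(φ) − Tr πm(φ) = Tr πSt(fH)`
    obtain ⟨-, hsum⟩ := hid fH _ hfH hφ htr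
    rw [F0P3cStCharTSShellKit.tsum_intCast_mul_eq_sub_of_support_pair aX (fun π : IrrClass (Gqs L v) => π.smoothTrace νQv ((DoubleCoset.doubleCoset (z * 𝓘.a) (𝓘.K n : Set ↥(unitaryGroupOfForm (conjLocal L (IsCMField.complexConj L) v) (cmLocalForm L 3 v))) (𝓘.K n)).indicator fun _ => (1 : ℂ)))
      hne hsupp hp1 hm1, ← hrp, ← hrm] at hsum
    -- «XIG» at `m = 1`
    have hbM1 : z * 𝓘.a ^ 1 ∈ (cmBorelTriple L 3 v).M := by rw [pow_one]; exact hbM'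
    have hR1 : IsLeftTransversal (𝓘.K n) (𝓘.K n ⊓ ConjAct.toConjAct (z * 𝓘.a ^ 1) • 𝓘.K n) R := by rw [pow_one]; exact hR
    have htr1 : IsLocalDeltaTransfer L (qsForm L) v ((finExplicitCollection L (qsForm L) μ (finExplicitDelta_conj_left_all L (qsForm L) μ) (finExplicitDelta_conj_right_all L (qsForm L) μ)) v) mHv mQv fH
        ((DoubleCoset.doubleCoset (z * 𝓘.a ^ 1) (𝓘.K n : Set ↥(unitaryGroupOfForm (conjLocal L (IsCMField.complexConj L) v) (cmLocalForm L 3 v))) (𝓘.K n)).indicator fun _ => (1 : ℂ)) := by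
      rw [pow_one]; exact htr
    have hXv := hX n hnX 1 le_rfl hbM1 R hR1 fH hfH htr1
    have hb1 : (⟨z * 𝓘.a ^ 1, hbM1⟩ : ↥(cmBorelTriple L 3 v).M) = ⟨z * 𝓘.a, hbM'⟩ :=
      Subtype.ext (by show z * 𝓘.a ^ 1 = z * 𝓘.a; rw [pow_one])
    rw [hb1] at hXv
    -- the four values in one currency, and the cancellation of `ν(K_n) · #R ≠ 0`
    have E1 : ρp.smoothTrace νQv ((DoubleCoset.doubleCoset (z * 𝓘.a) (𝓘.K n : Set ↥(unitaryGroupOfForm (conjLocal L (IsCMField.complexConj L) v) (cmLocalForm L 3 v))) (𝓘.K n)).indicator fun _ => (1 : ℂ)) = (νQv.real (𝓘.K n : Set ↥(unitaryGroupOfForm (conjLocal L (IsCMField.complexConj L) v) (cmLocalForm L 3 v))) : ℂ) * (R.card : ℂ) * (sp.map fun η : ↥(cmBorelTriple L 3 v).M →* ℂˣ => ((η ⟨z * 𝓘.a, hbM'⟩ : ℂˣ) : ℂ)).sum := hAp n hnp R hR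
    have E2 : ρm.smoothTrace νQv ((DoubleCoset.doubleCoset (z * 𝓘.a) (𝓘.K n : Set ↥(unitaryGroupOfForm (conjLocal L (IsCMField.complexConj L) v) (cmLocalForm L 3 v))) (𝓘.K n)).indicator fun _ => (1 : ℂ)) = (νQv.real (𝓘.K n : Set ↥(unitaryGroupOfForm (conjLocal L (IsCMField.complexConj L) v) (cmLocalForm L 3 v))) : ℂ) * (R.card : ℂ) * (sm.map fun η : ↥(cmBorelTriple L 3 v).M →* ℂˣ => ((η ⟨z * 𝓘.a, hbM'⟩ : ℂˣ) : ℂ)).sum := hAm n hnm R hR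
    have E3 : ρp.smoothTrace νQv ((DoubleCoset.doubleCoset (z * 𝓘.a) (𝓘.K n : Set ↥(unitaryGroupOfForm (conjLocal L (IsCMField.complexConj L) v) (cmLocalForm L 3 v))) (𝓘.K n)).indicator fun _ => (1 : ℂ)) - ρm.smoothTrace νQv ((DoubleCoset.doubleCoset (z * 𝓘.a) (𝓘.K n : Set ↥(unitaryGroupOfForm (conjLocal L (IsCMField.complexConj L) v) (cmLocalForm L 3 v))) (𝓘.K n)).indicator fun _ => (1 : ℂ)) = πSt.smoothTrace νHv fH := hsum
    have E4 : πSt.smoothTrace νHv fH = (νQv.real (𝓘.K n : Set ↥(unitaryGroupOfForm (conjLocal L (IsCMField.complexConj L) v) (cmLocalForm L 3 v))) : ℂ) * (R.card : ℂ) *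
        ((rootDeltaChar (cmBorelTriple L 3 v).P (Subgroup.inclusion (cmBorelTriple L 3 v).M_le ⟨z * 𝓘.a, hbM'⟩) : ℂˣ) : ℂ) *
          (((cmXiTorusChar L v (μ.semilocalComponent L v) (torusLocalComponent L (IsCMField.complexConj L) v ξ.η) (torusLocalComponent L (IsCMField.complexConj L) v ξ.ψ)) ⟨z * 𝓘.a, hbM'⟩ : ℂˣ) : ℂ) := hXv
    have hν : (νQv.real (𝓘.K n : Set ↥(unitaryGroupOfForm (conjLocal L (IsCMField.complexConj L) v) (cmLocalForm L 3 v))) : ℂ) * (R.card : ℂ) ≠ 0 := by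
      refine mul_ne_zero ?_ (Nat.cast_ne_zero.2 (Finset.card_pos.2 hR.nonempty).ne')
      -- positivity and finiteness of `ν(K_n)`, read on the model `Gqs L v` (where the organ's Haar instances live)
      have hKoG : IsOpen (X := Gqs L v) (𝓘.K n : Set ↥(unitaryGroupOfForm (conjLocal L (IsCMField.complexConj L) v) (cmLocalForm L 3 v))) := by
        exact hKo
      have hKcG : IsCompact (X := Gqs L v) (𝓘.K n : Set ↥(unitaryGroupOfForm (conjLocal L (IsCMField.complexConj L) v) (cmLocalForm L 3 v))) := by
        exact hKc
      rw [Complex.ofReal_ne_zero]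
      exact (ENNReal.toReal_pos (hKoG.measure_pos νQv ⟨1, (𝓘.K n).one_mem⟩).ne' (hKcG.measure_lt_top (μ := νQv)).ne).ne'
    have E5 : (νQv.real (𝓘.K n : Set ↥(unitaryGroupOfForm (conjLocal L (IsCMField.complexConj L) v) (cmLocalForm L 3 v))) : ℂ) * (R.card : ℂ) * ((sp.map fun η : ↥(cmBorelTriple L 3 v).M →* ℂˣ => ((η ⟨z * 𝓘.a, hbM'⟩ : ℂˣ) : ℂ)).sum - (sm.map fun η : ↥(cmBorelTriple L 3 v).M →* ℂˣ => ((η ⟨z * 𝓘.a, hbM'⟩ : ℂˣ) : ℂ)).sum) = (νQv.real (𝓘.K n : Set ↥(unitaryGroupOfForm (conjLocal L (IsCMField.complexConj L) v) (cmLocalForm L 3 v))) : ℂ) * (R.card : ℂ) * ((θξ ⟨z * 𝓘.a, hbM'⟩ : ℂˣ) : ℂ) := by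
      rw [mul_sub, ← E1, ← E2, E3, E4, hθχ, Units.val_mul, mul_assoc]
    rw [hbeq]
    exact mul_left_cancel₀ hν E5
  /- STEP 4 — Artin with multiplicities: `sp = sm + {θ_ξ}`; the three exported consequences. -/
  have hspm : sp = sm + {θξ} :=
    F0P3cStCharTSShellKit.eq_add_singleton_of_forall_sum_sub_sum_eq B hB hne' sp sm θξ fun b hb => hmain b (hBcone b hb)
  refine ⟨?_, ?_, ?_⟩
  · -- the virtual Jacquet-character identity: the eigencharacter multisets of `π_N(rp)`, `π_N(rm)` differ exactly by `δ_B^{1/2}χ_ξ`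
    exact ⟨sp, sm, hsp, hsm, hθξ ▸ hspm⟩
  · -- `dim V_N(rp) = dim V_N(rm) + 1`
    have h : Module.finrank ℂ ((cmBorelTriple L 3 v).restrict ρp).Coinvariants = Module.finrank ℂ ((cmBorelTriple L 3 v).restrict ρm).Coinvariants + 1 := by
      rw [← hcp, ← hcm, hspm, Multiset.card_add, Multiset.card_singleton]
    exact h
  · -- the quotient functional of `θ_ξ ∈ sp` as a non-zero `T`-map `r_B(rp) → ℂ_{χ_ξ}`
    have hθs : θξ ∈ sp := by rw [hspm]; exact Multiset.mem_add.2 (Or.inr (Multiset.mem_singleton_self _))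
    refine (hfp θξ hθs).elim fun ψ₀ hψ' => ?_
    exact @F0P3cStCharTSShellKit.exists_intertwiningMap_twist_of_functional ↥(unitaryGroupOfForm (conjLocal L (IsCMField.complexConj L) v) (cmLocalForm L 3 v)) inferInstance inferInstance iTG _ _ _ ρp
      (cmBorelTriple L 3 v) (locallyCompactSpace_cmBorelU L 3 v) θξ (cmXiTorusChar L v (μ.semilocalComponent L v) (torusLocalComponent L (IsCMField.complexConj L) v ξ.η) (torusLocalComponent L (IsCMField.complexConj L) v ξ.ψ)) hθχ ψ₀ hψ'.1 hψ'.2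

end Organ

end Summit.HodgeConjecture.HodgeConjecture.Cruxes.H413.F0P3cStCharTSVirtualJacquetOfXIG

end
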